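import Summits.RiemannHypothesis.RiemannHypothesis.Theorems.HandoffWindow
import Mathlib.NumberTheory.Chebyshev
import Mathlib.Analysis.SpecialFunctions.Log.Monotone
import Literature.NumberTheory.Sieve.SmoothSaddlePointApprox
import HarnessLib

/-!
# HANDOFF, edge block: the prime powers inside a prime gap are cheap — explicit Chebyshev bookkeeping (rh-explicit, track «HANDOFF», seat prove-2 gen2, ATTEMPT-6 §3(ii))

HONEST FRAMING. Nothing here bears on RH; elementary explicit estimates only. For consecutive primes `q < q′` the
atoms of Weil's explicit formula strictly inside the gap are prime POWERS `p^k`, `k ≥ 2`; their total weight is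
controlled by Mathlib's Chebyshev functions: `Σ_{q<n<q′} Λ(n) ≤ ψ(q′) − θ(q′) ≤ ψ(√q′) + 2ψ(q′^{1/3})`
(`Chebyshev.psi_sub_theta_eq_sum_not_prime`, `Chebyshev.psi_sub_theta_le_psi_add_psi_add_psi`), and
`ψ(y) ≤ log 4·y + 2√y log y` (`Chebyshev.psi_le`) with `log y/√y` bounded by `Real.log_div_sqrt_antitoneOn`.
Main output: `sum_Ioo_vonMangoldt_le` — for `q ≥ 10⁷` and `q′ ≤ 1.001 q`, `Σ_{q<n<q′} Λ(n) ≤ 2.1·√q` (PROVED), the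
input of `HandoffEdgeDusart.lean`. Numerical constants (`e⁴ ≥ 54.598`, `e⁸ ≥ 2980.9`, `e¹⁶ ≤ 10⁷`, `log 4 ≤ 1.3863`, …)
from Mathlib's nine-digit bounds on `e` and `log 2` (`log 4 ≤ 1.3863` is the tree's `Literature.NumberTheory.Sieve.log_four_le`).
-/

set_option linter.dupNamespace false

noncomputable section

open Set

namespace Summit.RiemannHypothesis.RiemannHypothesis.Theorems.Handoff

variable {q q' : ℕ}

/-! ### Numerical constants -/

/-- `exp 16 ≤ 10⁷`. [folklore] -/
theorem exp_sixteen_le : Real.exp 16 ≤ (10 : ℝ) ^ 7 := by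
  have h : Real.exp 16 = Real.exp 1 ^ 16 := by rw [← Real.exp_nat_mul]; norm_num
  rw [h]
  have h1 := Real.exp_one_lt_d9
  calc Real.exp 1 ^ 16 ≤ (2.7182818286 : ℝ) ^ 16 := pow_le_pow_left₀ (Real.exp_pos 1).le h1.le 16
    _ ≤ 10 ^ 7 := by norm_num

/-- `54.598 ≤ exp 4`. [folklore] -/
theorem exp_four_ge : (54.598 : ℝ) ≤ Real.exp 4 := by
  have h : Real.exp 4 = Real.exp 1 ^ 4 := by rw [← Real.exp_nat_mul]; norm_num
  rw [h]
  have h1 := Real.exp_one_gt_d9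
  calc (54.598 : ℝ) ≤ (2.7182818283 : ℝ) ^ 4 := by norm_num
    _ ≤ Real.exp 1 ^ 4 := pow_le_pow_left₀ (by norm_num) h1.le 4

/-- `7.389 ≤ exp 2`. [folklore] -/
theorem exp_two_ge : (7.389 : ℝ) ≤ Real.exp 2 := by
  have h : Real.exp 2 = Real.exp 1 ^ 2 := by rw [← Real.exp_nat_mul]; norm_num
  rw [h]
  have h1 := Real.exp_one_gt_d9
  calc (7.389 : ℝ) ≤ (2.7182818283 : ℝ) ^ 2 := by norm_num
    _ ≤ Real.exp 1 ^ 2 := pow_le_pow_left₀ (by norm_num) h1.le 2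

/-- `2980.9 ≤ exp 8`. [folklore] -/
theorem exp_eight_ge : (2980.9 : ℝ) ≤ Real.exp 8 := by
  have h : Real.exp 8 = Real.exp 1 ^ 8 := by rw [← Real.exp_nat_mul]; norm_num
  rw [h]
  have h1 := Real.exp_one_gt_d9
  calc (2980.9 : ℝ) ≤ (2.7182818283 : ℝ) ^ 8 := by norm_num
    _ ≤ Real.exp 1 ^ 8 := pow_le_pow_left₀ (by norm_num) h1.le 8

/-- `1000 ≤ exp 7`. [folklore] -/
theorem exp_seven_ge : (1000 : ℝ) ≤ Real.exp 7 := by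
  have h : Real.exp 7 = Real.exp 1 ^ 7 := by rw [← Real.exp_nat_mul]; norm_num
  rw [h]
  have h1 := Real.exp_one_gt_d9
  calc (1000 : ℝ) ≤ (2.7182818283 : ℝ) ^ 7 := by norm_num
    _ ≤ Real.exp 1 ^ 7 := pow_le_pow_left₀ (by norm_num) h1.le 7

/-- `12 ≤ exp (5/2)`. [folklore] -/
theorem exp_five_half_ge : (12 : ℝ) ≤ Real.exp (5 / 2) := by
  have h : Real.exp (5 / 2) = Real.exp 2 * Real.exp (1 / 2) := by rw [← Real.exp_add]; norm_num
  rw [h]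
  have h2 := exp_two_ge
  have h3 : (1 : ℝ) + 1 / 2 + (1 / 2) ^ 2 / 2 ≤ Real.exp (1 / 2) := Real.quadratic_le_exp_of_nonneg (by norm_num)
  nlinarith [Real.exp_pos (1 / 2 : ℝ)]

/-- `log x / √x ≤ 16/e⁸ ≤ 0.0054` for `x ≥ e¹⁶`. [folklore] -/
theorem log_div_sqrt_le_of_exp_sixteen_le {x : ℝ} (hx : Real.exp 16 ≤ x) : Real.log x / Real.sqrt x ≤ 0.0054 := by
  have h2 : Real.exp 2 ≤ Real.exp 16 := Real.exp_le_exp.2 (by norm_num)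
  have hanti := Real.log_div_sqrt_antitoneOn (Set.mem_Ici.2 h2) (Set.mem_Ici.2 (h2.trans hx)) hx
  have e1 : Real.log (Real.exp 16) = 16 := Real.log_exp 16
  have e2 : Real.sqrt (Real.exp 16) = Real.exp 8 := by
    rw [show (16 : ℝ) = 8 + 8 by norm_num, Real.exp_add, Real.sqrt_mul_self (Real.exp_pos 8).le]
  have h3 : Real.log x / Real.sqrt x ≤ 16 / Real.exp 8 := by simpa [e1, e2] using hanti
  refine h3.trans ?_
  rw [div_le_iff₀ (Real.exp_pos 8)]
  linarith [exp_eight_ge]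

/-- `log y / √y ≤ 8/e⁴ ≤ 0.147` for `y ≥ e⁸`. [folklore] -/
theorem log_div_sqrt_le_of_exp_eight_le {y : ℝ} (hy : Real.exp 8 ≤ y) : Real.log y / Real.sqrt y ≤ 0.147 := by
  have h2 : Real.exp 2 ≤ Real.exp 8 := Real.exp_le_exp.2 (by norm_num)
  have hanti := Real.log_div_sqrt_antitoneOn (Set.mem_Ici.2 h2) (Set.mem_Ici.2 (h2.trans hy)) hy
  have e1 : Real.log (Real.exp 8) = 8 := Real.log_exp 8
  have e2 : Real.sqrt (Real.exp 8) = Real.exp 4 := by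
    rw [show (8 : ℝ) = 4 + 4 by norm_num, Real.exp_add, Real.sqrt_mul_self (Real.exp_pos 4).le]
  have h3 : Real.log y / Real.sqrt y ≤ 8 / Real.exp 4 := by simpa [e1, e2] using hanti
  refine h3.trans ?_
  rw [div_le_iff₀ (Real.exp_pos 4)]
  linarith [exp_four_ge]

/-- `log z / √z ≤ 4/e² ≤ 0.55` for `z ≥ e⁴`. [folklore] -/
theorem log_div_sqrt_le_of_exp_four_le {z : ℝ} (hz : Real.exp 4 ≤ z) : Real.log z / Real.sqrt z ≤ 0.55 := by
  have h2 : Real.exp 2 ≤ Real.exp 4 := Real.exp_le_exp.2 (by norm_num)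
  have hanti := Real.log_div_sqrt_antitoneOn (Set.mem_Ici.2 h2) (Set.mem_Ici.2 (h2.trans hz)) hz
  have e1 : Real.log (Real.exp 4) = 4 := Real.log_exp 4
  have e2 : Real.sqrt (Real.exp 4) = Real.exp 2 := by
    rw [show (4 : ℝ) = 2 + 2 by norm_num, Real.exp_add, Real.sqrt_mul_self (Real.exp_pos 2).le]
  have h3 : Real.log z / Real.sqrt z ≤ 4 / Real.exp 2 := by simpa [e1, e2] using hanti
  refine h3.trans ?_
  rw [div_le_iff₀ (Real.exp_pos 2)]
  linarith [exp_two_ge]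

/-- Chebyshev with the logarithm absorbed: `ψ(y) ≤ 1.681·y` for `y ≥ e⁸` (Mathlib's `Chebyshev.psi_le`:
`ψ(y) ≤ log 4·y + 2√y log y`, and `√y log y = (log y/√y)·y ≤ 0.147·y`). [folklore] -/
theorem psi_le_of_exp_eight_le {y : ℝ} (hy : Real.exp 8 ≤ y) : Chebyshev.psi y ≤ 1.681 * y := by
  have hy0 : 0 < y := (Real.exp_pos 8).trans_le hy
  have hy1 : 1 ≤ y := by
    have : (1 : ℝ) ≤ Real.exp 8 := Real.one_le_exp (by norm_num)
    exact this.trans hy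
  have h := Chebyshev.psi_le hy1
  have hr := log_div_sqrt_le_of_exp_eight_le hy
  have hs : 0 < Real.sqrt y := Real.sqrt_pos.2 hy0
  have hkey : Real.sqrt y * Real.log y ≤ 0.147 * y := by
    have h1 : Real.log y ≤ 0.147 * Real.sqrt y := (div_le_iff₀ hs).1 hr
    have h2 := mul_le_mul_of_nonneg_left h1 hs.le
    have h3 := Real.mul_self_sqrt hy0.le
    calc Real.sqrt y * Real.log y ≤ Real.sqrt y * (0.147 * Real.sqrt y) := h2
      _ = 0.147 * (Real.sqrt y * Real.sqrt y) := by ring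
      _ = 0.147 * y := by rw [h3]
  have hl4 := Literature.NumberTheory.Sieve.log_four_le
  nlinarith [hkey, hl4, hy0]

/-- `ψ(z) ≤ 2.49·z` for `z ≥ e⁴`. [folklore] -/
theorem psi_le_of_exp_four_le {z : ℝ} (hz : Real.exp 4 ≤ z) : Chebyshev.psi z ≤ 2.49 * z := by
  have hz0 : 0 < z := (Real.exp_pos 4).trans_le hz
  have hz1 : 1 ≤ z := by
    have : (1 : ℝ) ≤ Real.exp 4 := Real.one_le_exp (by norm_num)
    exact this.trans hz
  have h := Chebyshev.psi_le hz1
  have hr := log_div_sqrt_le_of_exp_four_le hz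
  have hkey : Real.sqrt z * Real.log z ≤ 0.55 * z := by
    have hs : 0 < Real.sqrt z := Real.sqrt_pos.2 hz0
    have h1 : Real.log z ≤ 0.55 * Real.sqrt z := (div_le_iff₀ hs).1 hr
    have h2 := mul_le_mul_of_nonneg_left h1 hs.le
    have h3 := Real.mul_self_sqrt hz0.le
    calc Real.sqrt z * Real.log z ≤ Real.sqrt z * (0.55 * Real.sqrt z) := h2
      _ = 0.55 * (Real.sqrt z * Real.sqrt z) := by ring
      _ = 0.55 * z := by rw [h3]
  have hl4 := Literature.NumberTheory.Sieve.log_four_le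
  nlinarith [hkey, hl4, hz0]

/-! ### The prime powers strictly inside the gap, via Mathlib's `ψ − θ` -/

/-- Between consecutive primes only non-primes live, so `Σ_{q<n<q′} Λ(n) ≤ ψ(q′) − θ(q′)`
(`Chebyshev.psi_sub_theta_eq_sum_not_prime`). [folklore] -/
theorem sum_Ioo_vonMangoldt_le_psi_sub_theta (hcons : ConsecutivePrimes q q') :
    ∑ n ∈ Finset.Ioo q q', (ArithmeticFunction.vonMangoldt n : ℝ) ≤
      Chebyshev.psi q' - Chebyshev.theta q' := by
  rw [Chebyshev.psi_sub_theta_eq_sum_not_prime, Nat.floor_natCast]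
  refine Finset.sum_le_sum_of_subset_of_nonneg ?_ (fun n _ _ ↦ ArithmeticFunction.vonMangoldt_nonneg)
  intro n hn
  rw [Finset.mem_Ioo] at hn
  rw [Finset.mem_filter, Finset.mem_Ioc]
  refine ⟨⟨by omega, by omega⟩, fun hp ↦ ?_⟩
  have := hcons.2.2.2 n hp hn.1
  omega

/-- `ψ(x) − θ(x) ≤ ψ(√x) + 2ψ(x^{1/3})` for `x ≥ 1` (Mathlib's `psi_sub_theta_le_psi_add_psi_add_psi` and `x^{1/5} ≤ x^{1/3}`).
[folklore] -/
theorem psi_sub_theta_le_sqrt_add_two_cbrt {x : ℝ} (hx : 1 ≤ x) :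
    Chebyshev.psi x - Chebyshev.theta x ≤
      Chebyshev.psi (Real.sqrt x) + 2 * Chebyshev.psi (x ^ ((3 : ℝ)⁻¹)) := by
  have h := Chebyshev.psi_sub_theta_le_psi_add_psi_add_psi x
  have h5 : x ^ ((5 : ℝ)⁻¹) ≤ x ^ ((3 : ℝ)⁻¹) :=
    Real.rpow_le_rpow_of_exponent_le hx (by norm_num)
  have hmono := Chebyshev.psi_mono h5
  have hsq : x ^ ((2 : ℝ)⁻¹) = Real.sqrt x := by
    rw [Real.sqrt_eq_rpow, one_div]
  rw [hsq] at h
  linarith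

/-- **The prime powers inside the gap are cheap**: for consecutive primes `q < q′` with `10⁷ ≤ q` and `q′ ≤ 1.001·q`,
`Σ_{q<n<q′} Λ(n) ≤ 2.1·√q` (Chebyshev at `√q′ ≥ e⁸` and `q′^{1/3} ≥ e⁴`, `q′^{1/3} = √q′·q′^{−1/6} ≤ √q′·e^{−8/3}`).
[folklore; this track, ATTEMPT-6 §3(ii)] -/
theorem sum_Ioo_vonMangoldt_le (hcons : ConsecutivePrimes q q') (hq : (10 : ℝ) ^ 7 ≤ q)
    (hratio : (q' : ℝ) ≤ 1.001 * q) :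
    ∑ n ∈ Finset.Ioo q q', (ArithmeticFunction.vonMangoldt n : ℝ) ≤ 2.1 * Real.sqrt q := by
  have hq0 : (0 : ℝ) < q := by exact_mod_cast hcons.1.pos
  have hqq' : (q : ℝ) ≤ q' := by exact_mod_cast hcons.2.2.1.le
  have hq'0 : (0 : ℝ) < q' := hq0.trans_le hqq'
  have h16 : Real.exp 16 ≤ q := exp_sixteen_le.trans hq
  have h16' : Real.exp 16 ≤ q' := h16.trans hqq'
  have hq'1 : (1 : ℝ) ≤ q' := (Real.one_le_exp (by norm_num : (0:ℝ) ≤ 16)).trans h16'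
  -- √q′ ≥ e⁸ and q′^{1/3} ≥ e⁴
  have hsqrt : Real.exp 8 ≤ Real.sqrt q' := by
    have e2 : Real.sqrt (Real.exp 16) = Real.exp 8 := by
      rw [show (16 : ℝ) = 8 + 8 by norm_num, Real.exp_add, Real.sqrt_mul_self (Real.exp_pos 8).le]
    rw [← e2]
    exact Real.sqrt_le_sqrt h16'
  have hcbrt : Real.exp 4 ≤ (q' : ℝ) ^ ((3 : ℝ)⁻¹) := by
    have h12 : Real.exp 12 ≤ q' := (Real.exp_le_exp.2 (by norm_num : (12:ℝ) ≤ 16)).trans h16'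
    have e : Real.exp 12 ^ ((3 : ℝ)⁻¹) = Real.exp 4 := by
      rw [← Real.exp_mul]; norm_num
    rw [← e]
    exact Real.rpow_le_rpow (Real.exp_pos 12).le h12 (by norm_num)
  -- Chebyshev
  have h1 := sum_Ioo_vonMangoldt_le_psi_sub_theta hcons
  have h2 := psi_sub_theta_le_sqrt_add_two_cbrt hq'1
  have h3 := psi_le_of_exp_eight_le hsqrt
  have h4 := psi_le_of_exp_four_le hcbrt
  -- √q′ ≤ 1.0005 √q
  have hs : Real.sqrt q' ≤ 1.0005 * Real.sqrt q := by
    have hb : (q' : ℝ) ≤ (1.0005 * Real.sqrt q) ^ 2 := by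
      have := Real.sq_sqrt hq0.le
      nlinarith [this]
    exact Real.sqrt_le_iff.2 ⟨by positivity, hb⟩
  -- q′^{1/3} = √q′ · q′^{−1/6} ≤ √q′ · e^{−8/3} ≤ √q′ · 0.0834
  have hsplit : (q' : ℝ) ^ ((3 : ℝ)⁻¹) = Real.sqrt q' * (q' : ℝ) ^ (-(6 : ℝ)⁻¹) := by
    rw [Real.sqrt_eq_rpow, ← Real.rpow_add hq'0]
    norm_num
  have hsmall : (q' : ℝ) ^ (-(6 : ℝ)⁻¹) ≤ 0.0834 := by
    have ha : (q' : ℝ) ^ (-(6 : ℝ)⁻¹) ≤ Real.exp 16 ^ (-(6 : ℝ)⁻¹) :=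
      Real.rpow_le_rpow_of_nonpos (Real.exp_pos 16) h16' (by norm_num)
    have hb : Real.exp 16 ^ (-(6 : ℝ)⁻¹) = Real.exp (-(8 / 3)) := by
      rw [← Real.exp_mul]; norm_num
    have hc : Real.exp (-(8 / 3 : ℝ)) ≤ Real.exp (-(5 / 2)) := Real.exp_le_exp.2 (by norm_num)
    have hd : Real.exp (-(5 / 2 : ℝ)) ≤ 0.0834 := by
      rw [Real.exp_neg, inv_le_comm₀ (Real.exp_pos _) (by norm_num)]
      linarith [exp_five_half_ge]
    linarith [ha, hb.le, hb.ge, hc, hd]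
  have hcb : (q' : ℝ) ^ ((3 : ℝ)⁻¹) ≤ 0.0834 * Real.sqrt q' := by
    rw [hsplit, mul_comm (0.0834 : ℝ)]
    exact mul_le_mul_of_nonneg_left hsmall (Real.sqrt_nonneg _)
  have hsq0 : 0 ≤ Real.sqrt q := Real.sqrt_nonneg _
  have hsq'0 : 0 ≤ Real.sqrt q' := Real.sqrt_nonneg _
  nlinarith [h1, h2, h3, h4, hs, hcb, hsq0, hsq'0]

end Summit.RiemannHypothesis.RiemannHypothesis.Theorems.Handoff
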